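import Mathlib
import Summits.RiemannHypothesis.RiemannHypothesis.Theorems.WeilFarFloorCoshSplitRH
import Summits.RiemannHypothesis.RiemannHypothesis.Theorems.WeilFarFloorProfileDecomposition
import HarnessLib

/-!
# The archimedean energy of a residual with a linear small-scale modulus

Helper file (`--supports stmt-RiemannHypothesis-0098`, lead-track anchor: Weil-positivity window ladder, format-C far bound),
pure proofs, RH-free.  Seat rh-explicit-weil-1 gen12 (memo `run/shared/lean/pub/rh-explicit/rh-explicit-weil-1/FORMAT-K3.md` §13.7,
step (4)): toolkit for stage 3 of C-XIII″.

In the RH anatomy the archimedean energy of a real Weil test `r` is `ARCH(r) = ∫_{(0,∞)} ρ_∞(t)·D_t(r) dt`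
(`ρ_∞ = weilArchDensity = e^{t/2}/(2 sinh t)`, `D_t(r) = ∫(r(x+t) − r(x))²`).  For the residual `r = u − c·C_m` of stage 3 the
small scales carry a LINEAR modulus `D_t(r) ≤ M·t` (inherited from the envelope class of `u` and from the profile), while at large
scales only `D_t(r) ≤ 4∫r²` is used — and `∫r²` is tiny by profile rigidity.  This file is the corresponding budget:

* `archEnergy_le_of_linear_smallScale` : for a real Weil test `r`, `0 < t₀ ≤ 1`, `M ≥ 0` with `D_t(r) ≤ M·t` on `(0, t₀]`:
  `t ↦ ρ_∞(t)D_t(r)` is integrable on `(0,∞)` and **`ARCH(r) ≤ M·t₀ + 4·Ψ(t₀)·∫r²`** (`Ψ = weilArchTail`;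
  `tρ_∞(t) ≤ t + ½` via `FloorEnvelope.archBudget_small`, and `D_t ≤ 4∫r²` beyond `t₀`);
* `residual_increment_le` : if `D_t(u) ≤ (|t|/h)·N` for all `t` and `D_t(f) ≤ L·t` on `(0, 1]`, then for every real `c` and
  `t ∈ (0, 1]`: `D_t(u − c f) ≤ (2N/h + 2c²L)·t` (from `integral_sq_shiftAdd_residual_le`);
* bookkeeping: `abs_coeff_le` (`|c| ≤ ‖u‖/‖g‖`), `residual_sq_le_offProfile_add`
  (`‖r‖² ≤ (‖u‖² − (∫u f)²/‖f‖²) + 3‖u‖²‖f − g‖/‖f‖` — the residual against the mollified profile `g` is controlled by the profile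
  rigidity for the ORIGINAL profile `f`), `integral_sq_sub_le_two_mul_add` (`‖p − q‖² ≤ 2‖p − m‖² + 2‖m − q‖²`).
Standard axioms only.
-/

set_option linter.dupNamespace false
set_option autoImplicit false

noncomputable section

open MeasureTheory Set Filter
open scoped Real Topology

namespace Summit.RiemannHypothesis.RiemannHypothesis.Theorems.WeilFormatC

namespace FloorCoshSplit

open Literature.NumberTheory.LFunctions

variable {B : ℝ}

/-- **Archimedean budget of a test with a linear small-scale modulus.**  For a real Weil test `r` supported in `[−B, B]`,
`0 < t₀ ≤ 1`, `M ≥ 0` and `D_t(r) ≤ M·t` for `t ∈ (0, t₀]`: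
`∫_{(0,∞)} ρ_∞ D_t(r) ≤ M·t₀ + 4·Ψ(t₀)·∫r²`. -/
theorem archEnergy_le_of_linear_smallScale {r : ℝ → ℝ} (hr : IsWeilTest fun x ↦ (r x : ℂ))
    (hrs : tsupport (fun x ↦ (r x : ℂ)) ⊆ Icc (-B) B) {t₀ M : ℝ} (ht₀ : 0 < t₀) (ht₀1 : t₀ ≤ 1) (hM : 0 ≤ M)
    (hmod : ∀ t ∈ Ioc 0 t₀, ∫ x, (r (x + t) - r x) ^ 2 ≤ M * t) :
    IntegrableOn (fun t ↦ weilArchDensity t * ∫ x, (r (x + t) - r x) ^ 2) (Ioi 0) ∧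
      ∫ t in Ioi 0, weilArchDensity t * ∫ x, (r (x + t) - r x) ^ 2
        ≤ M * t₀ + 4 * weilArchTail t₀ * ∫ x, r x ^ 2 := by
  obtain ⟨-, hrm, ⟨Cr, hCr⟩, hrs0⟩ := weilTest_admissible hr hrs
  set R := ∫ x, r x ^ 2 with hR
  have hR0 : 0 ≤ R := integral_nonneg fun x ↦ sq_nonneg _
  -- the increments of the complexification are the real increments (tree: `MotivicDoor.AWS.weilIncrement_ofReal_eq`)
  have hinc : ∀ t, weilIncrement (fun x ↦ (r x : ℂ)) t = ∫ x, (r (x + t) - r x) ^ 2 := fun t ↦ by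
    unfold weilIncrement
    exact integral_congr_ae (Eventually.of_forall fun x ↦ by
      simp only [← Complex.ofReal_sub, Complex.norm_real, Real.norm_eq_abs, sq_abs])
  have hAi : IntegrableOn (fun t ↦ weilArchDensity t * ∫ x, (r (x + t) - r x) ^ 2) (Ioi 0) :=
    (integrableOn_weilArchDensity_mul_weilIncrement hr).congr_fun (fun t _ ↦ by simp only [hinc]) measurableSet_Ioi
  refine ⟨hAi, ?_⟩
  -- split `(0, ∞) = (0, t₀] ∪ (t₀, ∞)`
  have hunion : Ioc 0 t₀ ∪ Ioi t₀ = Ioi 0 := Ioc_union_Ioi_eq_Ioi ht₀.le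
  have hdisj : Disjoint (Ioc 0 t₀) (Ioi t₀) := fun s h1 h2 x hx ↦ (not_lt.2 (h1 hx).2 (h2 hx)).elim
  rw [← hunion, setIntegral_union hdisj measurableSet_Ioi (hAi.mono_set (hunion ▸ subset_union_left))
    (hAi.mono_set (hunion ▸ subset_union_right))]
  -- small scales: `ρ D_t ≤ ρ·min(2Mt₀, (t/t₀)(M t₀))` and `archBudget_small`
  have hsmall : ∫ t in Ioc 0 t₀, weilArchDensity t * ∫ x, (r (x + t) - r x) ^ 2 ≤ M * t₀ := by
    obtain ⟨hi, hle⟩ := FloorEnvelope.archBudget_small (h := t₀) (N := M * t₀) ht₀ ht₀1 (by positivity)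
    refine le_trans (setIntegral_mono_on (hAi.mono_set Ioc_subset_Ioi_self) hi measurableSet_Ioc fun t ht ↦ ?_) hle
    refine mul_le_mul_of_nonneg_left ?_ (weilArchDensity_pos ht.1).le
    have h1 := hmod t ht
    have h2 : t / t₀ * (M * t₀) = M * t := by field_simp
    have h3 : M * t ≤ 2 * (M * t₀) := by nlinarith [ht.2, ht.1]
    exact h1.trans (le_min h3 (le_of_eq h2.symm))
  -- large scales: `D_t ≤ 4R`
  have hlarge : ∫ t in Ioi t₀, weilArchDensity t * ∫ x, (r (x + t) - r x) ^ 2 ≤ 4 * weilArchTail t₀ * R := by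
    have hρi : IntegrableOn weilArchDensity (Ioi t₀) := integrableOn_weilArchDensity_Ioi ht₀
    calc ∫ t in Ioi t₀, weilArchDensity t * ∫ x, (r (x + t) - r x) ^ 2
        ≤ ∫ t in Ioi t₀, weilArchDensity t * (4 * R) := by
          refine setIntegral_mono_on (hAi.mono_set (Ioi_subset_Ioi ht₀.le)) (hρi.mul_const _) measurableSet_Ioi
            fun t ht ↦ mul_le_mul_of_nonneg_left ?_ (weilArchDensity_pos (ht₀.trans ht)).le
          exact integral_sq_shiftAdd_sub_le_four_mul hrm hCr hrs0 t
      _ = 4 * weilArchTail t₀ * R := by rw [integral_mul_const, weilArchTail]; ring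
  linarith

/-- **The residual's small-scale modulus.**  If `D_t(u) ≤ (|t|/h)·N` for all `t` and `D_t(f) ≤ L·t` on `(0, 1]` (admissible `u, f`
on `[−B, B]`), then `D_t(u − c f) ≤ (2N/h + 2c²L)·t` for `t ∈ (0, 1]` and every real `c`. -/
theorem residual_increment_le {u f : ℝ → ℝ} {Cu Cf h N L : ℝ} (hu : Measurable u) (hf : Measurable f)
    (hCu : ∀ x, |u x| ≤ Cu) (hCf : ∀ x, |f x| ≤ Cf) (hus : ∀ x, x ∉ Icc (-B) B → u x = 0)
    (hfs : ∀ x, x ∉ Icc (-B) B → f x = 0) (hh : 0 < h)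
    (hmodu : ∀ t, ∫ x, (u (x + t) - u x) ^ 2 ≤ |t| / h * N)
    (hmodf : ∀ t ∈ Ioc (0 : ℝ) 1, ∫ x, (f (x + t) - f x) ^ 2 ≤ L * t) (c : ℝ) {t : ℝ} (ht : t ∈ Ioc (0 : ℝ) 1) :
    ∫ x, ((u (x + t) - c * f (x + t)) - (u x - c * f x)) ^ 2 ≤ (2 * N / h + 2 * c ^ 2 * L) * t := by
  have h1 := integral_sq_shiftAdd_residual_le hu hf hCu hCf hus hfs c t
  have h2 := hmodu t
  rw [abs_of_pos ht.1] at h2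
  have h3 := hmodf t ht
  have hc : 0 ≤ c ^ 2 := sq_nonneg c
  calc ∫ x, ((u (x + t) - c * f (x + t)) - (u x - c * f x)) ^ 2
      ≤ 2 * (∫ x, (u (x + t) - u x) ^ 2) + 2 * c ^ 2 * ∫ x, (f (x + t) - f x) ^ 2 := h1
    _ ≤ 2 * (t / h * N) + 2 * c ^ 2 * (L * t) := by nlinarith [mul_le_mul_of_nonneg_left h3 hc]
    _ = (2 * N / h + 2 * c ^ 2 * L) * t := by field_simp

/-! ## Bookkeeping helpers for the residual -/

/-- **`|c| ≤ ‖u‖/‖g‖`** for the projection coefficient `c = ∫ug/∫g²` (Bessel). -/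
theorem abs_coeff_le {u g : ℝ → ℝ} {Cu Cg : ℝ} (hu : Measurable u) (hg : Measurable g) (hCu : ∀ x, |u x| ≤ Cu)
    (hCg : ∀ x, |g x| ≤ Cg) (hus : ∀ x, x ∉ Icc (-B) B → u x = 0) (hgs : ∀ x, x ∉ Icc (-B) B → g x = 0)
    (hg0 : 0 < ∫ x, g x ^ 2) :
    |(∫ x, u x * g x) / ∫ x, g x ^ 2| ≤ Real.sqrt (∫ x, u x ^ 2) / Real.sqrt (∫ x, g x ^ 2) := by
  obtain ⟨hB, -⟩ := profile_energy_le hu hg hCu hCg hus hgs hg0.ne'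
  rw [le_div_iff₀ (Real.sqrt_pos.2 hg0), ← Real.sqrt_sq_eq_abs, ← Real.sqrt_mul (sq_nonneg _)]
  exact Real.sqrt_le_sqrt hB

/-- **The residual's energy against the ORIGINAL profile**: with `c = ∫ug/∫g²`, `r = u − c·g` and a reference profile `f`
(`0 < ∫g² ≤ ∫f²`, `∫(f−g)² ≤ ∫f²`): `∫r² ≤ (∫u² − (∫uf)²/∫f²) + 3∫u²·‖f − g‖₂/‖f‖₂`
(Pythagoras for `g` + `sq_proj_div_sub_le`; use: `f = C_b` where profile rigidity controls `∫u² − (∫u C_b)²/‖C_b‖²`, `g = C_m`). -/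
theorem residual_sq_le_offProfile_add {u f g : ℝ → ℝ} {Cu Cf Cg : ℝ} (hu : Measurable u) (hf : Measurable f)
    (hg : Measurable g) (hCu : ∀ x, |u x| ≤ Cu) (hCf : ∀ x, |f x| ≤ Cf) (hCg : ∀ x, |g x| ≤ Cg)
    (hus : ∀ x, x ∉ Icc (-B) B → u x = 0) (hfs : ∀ x, x ∉ Icc (-B) B → f x = 0) (hgs : ∀ x, x ∉ Icc (-B) B → g x = 0)
    (hg0 : 0 < ∫ x, g x ^ 2) (hgf : ∫ x, g x ^ 2 ≤ ∫ x, f x ^ 2) (hdf : ∫ x, (f x - g x) ^ 2 ≤ ∫ x, f x ^ 2) :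
    ∫ x, (u x - (∫ y, u y * g y) / (∫ y, g y ^ 2) * g x) ^ 2
      ≤ ((∫ x, u x ^ 2) - (∫ x, u x * f x) ^ 2 / ∫ x, f x ^ 2)
        + 3 * (∫ x, u x ^ 2) * Real.sqrt (∫ x, (f x - g x) ^ 2) / Real.sqrt (∫ x, f x ^ 2) := by
  have hP := integral_sq_eq_profile_add_residual hu hg hCu hCg hus hgs hg0.ne'
  have hcmp := sq_proj_div_sub_le hu hf hg hCu hCf hCg hus hfs hgs hg0 hgf hdf
  have e : ((∫ y, u y * g y) / ∫ y, g y ^ 2) ^ 2 * (∫ x, g x ^ 2) = (∫ x, u x * g x) ^ 2 / ∫ x, g x ^ 2 := by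
    field_simp
  linarith

/-- `L²` triangle inequality in squared form: `∫(p − q)² ≤ 2∫(p − m)² + 2∫(m − q)²` for admissible `p, q, m` on `[−B, B]`. -/
theorem integral_sq_sub_le_two_mul_add {p q m : ℝ → ℝ} {Cp Cq Cm : ℝ} (hp : Measurable p) (hq : Measurable q)
    (hm : Measurable m) (hCp : ∀ x, |p x| ≤ Cp) (hCq : ∀ x, |q x| ≤ Cq) (hCm : ∀ x, |m x| ≤ Cm)
    (hps : ∀ x, x ∉ Icc (-B) B → p x = 0) (hqs : ∀ x, x ∉ Icc (-B) B → q x = 0)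
    (hms : ∀ x, x ∉ Icc (-B) B → m x = 0) :
    ∫ x, (p x - q x) ^ 2 ≤ 2 * (∫ x, (p x - m x) ^ 2) + 2 * ∫ x, (m x - q x) ^ 2 := by
  have had : ∀ {v w : ℝ → ℝ} {Cv Cw : ℝ}, Measurable v → Measurable w → (∀ x, |v x| ≤ Cv) → (∀ x, |w x| ≤ Cw) →
      (∀ x, x ∉ Icc (-B) B → v x = 0) → (∀ x, x ∉ Icc (-B) B → w x = 0) →
      Integrable fun x ↦ (v x - w x) ^ 2 := by
    intro v w Cv Cw hv hw hCv hCw hvs hws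
    obtain ⟨hdm, hdb, hds⟩ : Measurable (fun x ↦ v x - w x) ∧ (∀ x, |v x - w x| ≤ Cv + Cw) ∧
        (∀ x, x ∉ Icc (-B) B → v x - w x = 0) :=
      ⟨hv.sub hw, fun x ↦ (abs_sub _ _).trans (add_le_add (hCv x) (hCw x)), fun x hx ↦ by rw [hvs x hx, hws x hx, sub_zero]⟩
    exact (integrable_admissible_mul hdm hdm hdb hdb hds).congr (Eventually.of_forall fun x ↦ by simp only; ring)
  have i1 := had hp hm hCp hCm hps hms
  have i2 := had hm hq hCm hCq hms hqs
  rw [← integral_const_mul, ← integral_const_mul, ← integral_add (i1.const_mul 2) (i2.const_mul 2)]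
  refine integral_mono_of_nonneg (Eventually.of_forall fun x ↦ sq_nonneg _) ((i1.const_mul 2).add (i2.const_mul 2))
    (Eventually.of_forall fun x ↦ ?_)
  nlinarith [sq_nonneg ((p x - m x) - (m x - q x))]

end FloorCoshSplit

end Summit.RiemannHypothesis.RiemannHypothesis.Theorems.WeilFormatC
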